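import Literature.AlgebraicGeometry.GroupSchemes.EtaleKernelDecidedOnPoints
import Literature.AlgebraicGeometry.AbelianSchemes.IsogenyOfFiniteKernelOnPoints
import Literature.AlgebraicGeometry.AbelianSchemes.SerreTensorRecognition
import Literature.AlgebraicGeometry.AbelianSchemes.AbelianSchemeHomDescentKernelEq
import HarnessLib

/-!
# Recognition of the Serre tensor FROM Ω-POINTS: a surjective homomorphism out of `A` killing exactly `A[𝔭](Ω)` IS `A ⟶ A ⊗_𝒪 𝔭⁻¹`
# (`Ω = Ω̄` of characteristic zero; no degree count)

Topic `Literature/AlgebraicGeometry/AbelianSchemes`, namespace `Literature.AlgebraicGeometry.AbelianSchemes.AbelianSchemeOver`.  THEOREMS ONLY (no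
definition, no named fact, no `instance`, no notation, no `sorry`).  Cell `hodgecm-mathlib` (D-0151), FLOOR 0, P6 «MOD programme» (crux hLiu418 =
stmt-HodgeConjecture-24832, `--supports`, count-neutral), σ2 (β′) lineage of `stub_HFROB`, organ **G1b «THE ROOF TARGET IS THE SERRE TENSOR»** (KIT memo v2
§3): in the isogeny roof `A_y —q→ B ←c— A_y″` of the moduli datum (`RoofΩ`), (r2) says `c` is SURJECTIVE with `Ker c(Ω) = A_y″[𝔞](Ω)` ON `Ω`-POINTS and (r4)
says `c` intertwines `ι(a)` with some endomorphism of `B`; this file concludes `B ≅ A_y″ ⊗_𝒪 𝔞⁻¹` UNDER `A_y″`, canonically and equivariantly — so the roof's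
middle has the ★ `R`-model `serreTensor` and ★ `FrobeniusVersusHeckeSerreTensor` ∕ ★ `SerreTranslateComposition` apply downstairs.  Compared with ★
`SerreTensorRecognition.exists_iso_serreTranslate_comp_eq_of_forall_comp_eq_one` ([MumfordAV1970] §7 Thm. 4 + DEGREES; kernel inclusion on all
`T`-points) no degree is counted and only `Ω`-points are inspected: over `Ω = Ω̄` of characteristic `0` both `φ` and `ψ_P : A → A ⊗ 𝔟` are isogenies with
finite ÉTALE kernels, so «same kernel on `Ω`-points» is «same kernel as subgroup functors» (★ `EtaleKernelDecidedOnPoints`, [Tate1997FiniteFlatGroupSchemes]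
(3.7)) and the rank-free descent ★ `AbelianSchemeHomDescentKernelEq` applies.  HC_CM is proved only modulo the 2 remaining named inputs (hLiu418, h413)
until rung 0 closes; this file discharges none of them.

## Contents (`act : 𝒪 → End A`, presented module `𝔟 = E′𝒪ᵐ`, `P ∈ 𝔟` with coordinates generating `𝔭`, quasi-inverse row `Q` up to `N ≠ 0`;
`φ : A → B` a homomorphism of abelian `Ω`-schemes)
* §1 `natCast_mem_of_quasiInverse` (`N ∈ 𝔭`), `pow_eq_one_of_forall_mem` (a point killed by `ι(𝔭)` is `N`-torsion), `flat_left_of_isFinite_of_surjective`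
  (Cartier-free: ★ `IsIsogeny.flat`), `isFinite_left_of_surjective_of_forall_points` (★ `IsogenyOfFiniteKernelOnPoints`).
* §2 **`exists_iso_serreTranslate_comp_eq_of_forall_points_of_charZero`** — `φ.left` surjective and
  `∀ Pt ∈ A(Ω), φ(Pt) = 1 ↔ ∀ a ∈ 𝔭, ι(a)(Pt) = 1` ⇒ `∃ e : A ⊗_𝒪 𝔟 ≅ B`, `ψ_P ≫ e = φ`, `e` a homomorphism, unique; **`…_equivariant…`** — with
  (r4)-shaped intertwiners `ι(a) ≫ φ = φ ≫ b` the isomorphism intertwines the Serre action with `b`; with an `𝒪`-action on `B` making `φ` equivariant, `e` is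
  `𝒪`-equivariant; `comp_eq_one_iff_forall_mem_of_forall_points_of_charZero` (then `Ker φ = A[𝔭]` as subgroup functors).
* §3 (`Ω = Ω̄`, ANY characteristic — the special twin `Roof₀` (r2₀)) **`exists_iso_serreTranslate_comp_eq_of_comp_eq_one_iff_forall_mem`** — `φ.left` surjective and
  `Ker φ = A[𝔭]` as subgroup functors ⇒ the same conclusion, rank-free; **`…_equivariant_…`**.

## References
* [MumfordAV1970] D. Mumford, *Abelian Varieties* (1970), §7 Thm. 4 (p. 72).
* [MilneCM2006] J. S. Milne, *Complex Multiplication* (2006), §7 (Def. 7.19, Prop. 7.22, Rem. 7.23, pp. 58–59).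
* [Conrad2004GrossZagier] B. Conrad, *Gross–Zagier revisited*, MSRI Publ. 49 (2004), §7 (Thm. 7.5).
* [Tate1997FiniteFlatGroupSchemes] J. Tate, *Finite flat group schemes* (1997), (3.7).
-/

noncomputable section

universe u

open CategoryTheory CategoryTheory.Limits AlgebraicGeometry MonoidalCategory CartesianMonoidalCategory
open scoped MonObj

namespace Literature.AlgebraicGeometry.AbelianSchemes

namespace AbelianSchemeOver

open Literature.AlgebraicGeometry.Motives (AlgPoints SchemeOver specOver)
open Literature.AlgebraicGeometry.Motives.AbelianVariety (IsIsogeny)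

variable {Ω : Type u} [Field Ω] {A B : AbelianSchemeOver (Spec (.of Ω))} {O : Type*} [CommRing O] (act : A.RingAction O)
  {m : ℕ} (E' : Matrix (Fin m) (Fin m) O) (hE' : E' * E' = E') (P : Matrix (Fin m) (Fin 1) O) (Q : Matrix (Fin 1) (Fin m) O) {N : ℕ}
  (φ : A.X ⟶ B.X) [IsMonHom φ]

/-! ## §1 Bookkeeping -/

omit hE' in
/-- `N ∈ 𝔭`: the quasi-inverse identity `Q·P = N` exhibits `N` as an `𝒪`-combination of the coordinates of `P`. [cite: Conrad2004GrossZagier, §7 (Thm. 7.5)] -/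
theorem natCast_mem_of_quasiInverse (hQP : Q * P = Matrix.scalar (Fin 1) (N : O)) {𝔭 : Ideal O}
    (h𝔭 : Ideal.span (Set.range fun k => P k 0) = 𝔭) : (N : O) ∈ 𝔭 := by
  have h : (Q * P) 0 0 = (N : O) := by rw [hQP, Matrix.scalar_apply, Matrix.diagonal_apply_eq]
  rw [← h, Matrix.mul_apply, ← h𝔭]
  exact Ideal.sum_mem _ fun k _ => Ideal.mul_mem_left _ _ (Ideal.subset_span ⟨k, rfl⟩)

/-- A point `Pt : Spec Ω → A` killed by `ι(a)` for all `a ∈ 𝔭` is `N`-torsion for any natural number `N ∈ 𝔭` (`ι(N) = [N]`, ★ `RingAction.i_natCast`).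
[cite: MumfordAV1970, §6 Application 3 (pp. 62–64)] -/
theorem pow_eq_one_of_forall_mem {𝔭 : Ideal O} (hN𝔭 : (N : O) ∈ 𝔭) (Pt : specOver Ω Ω ⟶ A.X)
    (h : ∀ a ∈ 𝔭, Pt ≫ act.i a = 1) : Pt ^ N = 1 := by
  have h1 := h (N : O) hN𝔭
  rw [RingAction.i_natCast, MonObj.comp_pow, Category.comp_id] at h1
  exact h1

/-- A homomorphism of abelian `Ω`-schemes with `φ.left` finite surjective (an isogeny) is FLAT (★ `IsIsogeny.flat`, [MumfordFogartyKirwan1994] Lemma 6.12).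
[cite: GortzWedhorn2023, Prop. 27.176] -/
theorem flat_left_of_isFinite_of_surjective [IsFinite φ.left] [Surjective φ.left] : Flat φ.left :=
  IsIsogeny.flat (f := homOfIsMonHom φ) ⟨‹_›, ‹_›⟩

/-- `φ.left` is FINITE when `φ` is surjective and kills, on `Ω`-points, only points killed by `ι(𝔭)` with `0 ≠ N ∈ 𝔭` (`Ω = Ω̄`; finitely many kernel points,
★ `IsogenyOfFiniteKernelOnPoints`). [cite: MumfordAV1970, §6 Application 3 (pp. 62–64), §19 Thm. 1 (proof, p. 174)] [cite: GortzWedhorn2023, Cor. 27.177] -/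
theorem isFinite_left_of_surjective_of_forall_points [IsAlgClosed Ω] [Surjective φ.left] (hN : N ≠ 0) {𝔭 : Ideal O} (hN𝔭 : (N : O) ∈ 𝔭)
    (hker : ∀ Pt : A.toAffine.toAbelianVariety.Points Ω, (AlgPoints.map φ Pt : B.toAffine.toAbelianVariety.Points Ω) = 1 →
      ∀ a ∈ 𝔭, (AlgPoints.map (act.i a) Pt : A.toAffine.toAbelianVariety.Points Ω) = 1) : IsFinite φ.left :=
  isFinite_left_of_surjective_of_finite_setOf_map_eq_one φ
    (finite_setOf_map_eq_one_of_pow_eq_one φ N hN fun Pt hPt => pow_eq_one_of_forall_mem act hN𝔭 Pt (hker Pt hPt))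

/-! ## §2 Recognition from `Ω`-points -/

section Recognition

variable [IsAlgClosed Ω] [CharZero Ω] [IsCommMonObj A.X]

/-- **RECOGNITION OF THE SERRE TENSOR FROM `Ω`-POINTS** (`Ω = Ω̄`, `char Ω = 0`; no degree count): `ψ_P : A → A ⊗_𝒪 𝔟` the Serre translate (coordinates of
`P` generating `𝔭`, quasi-inverse `Q` up to `N ≠ 0`), `φ : A → B` a homomorphism with `φ.left` SURJECTIVE and `Ker φ(Ω) = A[𝔭](Ω)`:
`φ(Pt) = 1 ↔ ∀ a ∈ 𝔭, ι(a)(Pt) = 1` for `Pt ∈ A(Ω)`.  THEN there is an isomorphism `e : A ⊗_𝒪 𝔟 ≅ B` over `Spec Ω` with `ψ_P ≫ e = φ`; it is a homomorphism and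
the unique factorisation — «`B = A ⊗_𝒪 𝔭⁻¹` under `A`» (the shape of `RoofΩ` (r2)). [cite: MumfordAV1970, §7 Thm. 4 (p. 72)]
[cite: MilneCM2006, §7 (Def. 7.19, Prop. 7.22, Rem. 7.23, pp. 58–59)] [cite: Tate1997FiniteFlatGroupSchemes, (3.7)] -/
theorem exists_iso_serreTranslate_comp_eq_of_forall_points_of_charZero [Surjective φ.left]
    (hN : N ≠ 0) (hP : E' * P = P) (hQ : Q * E' = Q)
    (hQP : Q * P = Matrix.scalar (Fin 1) (N : O)) (hPQ : P * Q = Matrix.scalar (Fin m) (N : O) * E')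
    {𝔭 : Ideal O} (h𝔭 : Ideal.span (Set.range fun k => P k 0) = 𝔭)
    (hker : ∀ Pt : A.toAffine.toAbelianVariety.Points Ω, (AlgPoints.map φ Pt : B.toAffine.toAbelianVariety.Points Ω) = 1 ↔
      ∀ a ∈ 𝔭, (AlgPoints.map (act.i a) Pt : A.toAffine.toAbelianVariety.Points Ω) = 1) :
    ∃ e : (serreTensor act E' hE').X ≅ B.X, serreTranslate act E' hE' P ≫ e.hom = φ ∧ IsMonHom e.hom ∧
      ∀ χ : (serreTensor act E' hE').X ⟶ B.X, serreTranslate act E' hE' P ≫ χ = φ → χ = e.hom := by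
  haveI := isMonHom_serreTranslate act E' hE' P
  haveI := isFinite_serreTranslate_left act E' hE' P Q hN hP hQ hQP hPQ
  haveI := flat_serreTranslate_left act E' hE' P Q hN hP hQ hQP hPQ
  haveI := surjective_serreTranslate_left act E' hE' P Q hN hP hQ hQP hPQ
  have hN𝔭 : (N : O) ∈ 𝔭 := natCast_mem_of_quasiInverse P Q hQP h𝔭
  haveI : IsFinite φ.left := isFinite_left_of_surjective_of_forall_points act φ hN hN𝔭 fun Pt hPt => (hker Pt).1 hPt
  haveI : Flat φ.left := flat_left_of_isFinite_of_surjective φ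
  have hψ : ∀ ⦃T : Over (Spec (.of Ω))⦄ (t : T ⟶ A.X), t ≫ serreTranslate act E' hE' P = 1 ↔ ∀ a, a ∈ 𝔭 → t ≫ act.i a = 1 :=
    fun T t => comp_serreTranslate_eq_one_iff_forall_mem act E' hE' P hP h𝔭 t
  have hφ : ∀ ⦃T : Over (Spec (.of Ω))⦄ (t : T ⟶ A.X), t ≫ φ = 1 ↔ ∀ a, a ∈ 𝔭 → t ≫ act.i a = 1 :=
    comp_eq_one_iff_forall_of_forall_points_of_charZero φ (serreTranslate act E' hE' P) (fun a : O => a ∈ 𝔭) (fun _ => A)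
      (fun a => act.i a) hψ hker
  exact A.exists_iso_comp_eq_of_comp_eq_one_iff (serreTranslate act E' hE' P) φ fun T t => (hψ t).trans (hφ t).symm

include hE' in
/-- … and then `Ker φ = A[𝔭]` AS SUBGROUP FUNCTORS: `t ≫ φ = 1 ↔ ∀ a ∈ 𝔭, t ≫ ι(a) = 1` for every `T`-valued point `t` (the `hker` shape of ★
`FrobeniusVersusHeckeSerreTensor`). [cite: MumfordAV1970, §7 Thm. 4 (p. 72)] [cite: Tate1997FiniteFlatGroupSchemes, (3.7)] -/
theorem comp_eq_one_iff_forall_mem_of_forall_points_of_charZero [Surjective φ.left]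
    (hN : N ≠ 0) (hP : E' * P = P) (hQ : Q * E' = Q)
    (hQP : Q * P = Matrix.scalar (Fin 1) (N : O)) (hPQ : P * Q = Matrix.scalar (Fin m) (N : O) * E')
    {𝔭 : Ideal O} (h𝔭 : Ideal.span (Set.range fun k => P k 0) = 𝔭)
    (hker : ∀ Pt : A.toAffine.toAbelianVariety.Points Ω, (AlgPoints.map φ Pt : B.toAffine.toAbelianVariety.Points Ω) = 1 ↔
      ∀ a ∈ 𝔭, (AlgPoints.map (act.i a) Pt : A.toAffine.toAbelianVariety.Points Ω) = 1)
    ⦃T : Over (Spec (.of Ω))⦄ (t : T ⟶ A.X) : t ≫ φ = 1 ↔ ∀ a ∈ 𝔭, t ≫ act.i a = 1 := by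
  obtain ⟨e, he, hmon, -⟩ := exists_iso_serreTranslate_comp_eq_of_forall_points_of_charZero act E' hE' P Q φ hN hP hQ hQP hPQ h𝔭 hker
  haveI := hmon
  exact comp_eq_one_iff_forall_mem_of_serreTranslate_comp_eq act E' hE' P φ hP h𝔭 e he t

omit [IsMonHom φ] [IsAlgClosed Ω] [CharZero Ω] in
/-- **… EQUIVARIANTLY, (r4) shape**: if `ι(a) ≫ φ = φ ≫ b` for some endomorphism `b` of `B`, then the isomorphism `e` of
`exists_iso_serreTranslate_comp_eq_of_forall_points_of_charZero` (indeed any homomorphism `e` with `ψ_P ≫ e = φ`) intertwines the Serre action with `b`: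
`ι_{A⊗𝔟}(a) ≫ e = e ≫ b` (cancel the fppf epimorphism `ψ_P`). [cite: MumfordAV1970, §7 Thm. 4 (p. 72)] [cite: Conrad2004GrossZagier, §7 (Thm. 7.5)] -/
theorem serreAction_comp_eq_comp_of_comp_eq (hN : N ≠ 0) (hP : E' * P = P) (hQ : Q * E' = Q)
    (hQP : Q * P = Matrix.scalar (Fin 1) (N : O)) (hPQ : P * Q = Matrix.scalar (Fin m) (N : O) * E')
    (e : (serreTensor act E' hE').X ⟶ B.X) (he : serreTranslate act E' hE' P ≫ e = φ)
    (a : O) (b : B.X ⟶ B.X) (hab : act.i a ≫ φ = φ ≫ b) : (serreAction act E' hE').i a ≫ e = e ≫ b := by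
  haveI := flat_serreTranslate_left act E' hE' P Q hN hP hQ hQP hPQ
  haveI := surjective_serreTranslate_left act E' hE' P Q hN hP hQ hQP hPQ
  haveI := quasiCompact_serreTranslate_left act E' hE' P Q hN hP hQ hQP hPQ
  apply A.cancel_left_of_flat_surjective (serreTranslate act E' hE' P)
  rw [← Category.assoc, ← i_comp_serreTranslate act E' hE' P hP a, Category.assoc, he, hab, ← Category.assoc, he]

/-- **RECOGNITION FROM `Ω`-POINTS, `𝒪`-EQUIVARIANT FORM**: with an `𝒪`-action `ι_B` on `B` making `φ` equivariant, the isomorphism `e : A ⊗_𝒪 𝔟 ≅ B` is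
`𝒪`-equivariant for the Serre action and `ι_B`. [cite: MumfordAV1970, §7 Thm. 4 (p. 72)] [cite: MilneCM2006, §7 (Def. 7.19, Prop. 7.22, Rem. 7.23, pp. 58–59)]
[cite: Tate1997FiniteFlatGroupSchemes, (3.7)] -/
theorem exists_iso_serreTranslate_comp_eq_equivariant_of_forall_points_of_charZero [Surjective φ.left] (actB : B.RingAction O)
    (hN : N ≠ 0) (hP : E' * P = P) (hQ : Q * E' = Q)
    (hQP : Q * P = Matrix.scalar (Fin 1) (N : O)) (hPQ : P * Q = Matrix.scalar (Fin m) (N : O) * E')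
    {𝔭 : Ideal O} (h𝔭 : Ideal.span (Set.range fun k => P k 0) = 𝔭)
    (hφ : ∀ a, act.i a ≫ φ = φ ≫ actB.i a)
    (hker : ∀ Pt : A.toAffine.toAbelianVariety.Points Ω, (AlgPoints.map φ Pt : B.toAffine.toAbelianVariety.Points Ω) = 1 ↔
      ∀ a ∈ 𝔭, (AlgPoints.map (act.i a) Pt : A.toAffine.toAbelianVariety.Points Ω) = 1) :
    ∃ e : (serreTensor act E' hE').X ≅ B.X, serreTranslate act E' hE' P ≫ e.hom = φ ∧ IsMonHom e.hom ∧
      (∀ a, (serreAction act E' hE').i a ≫ e.hom = e.hom ≫ actB.i a) ∧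
        ∀ χ : (serreTensor act E' hE').X ⟶ B.X, serreTranslate act E' hE' P ≫ χ = φ → χ = e.hom := by
  obtain ⟨e, he, hmon, huniq⟩ := exists_iso_serreTranslate_comp_eq_of_forall_points_of_charZero act E' hE' P Q φ hN hP hQ hQP hPQ h𝔭 hker
  exact ⟨e, he, hmon, fun a => serreAction_comp_eq_comp_of_comp_eq act E' hE' P Q φ hN hP hQ hQP hPQ e.hom he a (actB.i a) (hφ a), huniq⟩

end Recognition

/-! ## §3 Any characteristic: recognition from the SCHEME-THEORETIC kernel (the special twin `Roof₀` (r2₀):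
`t ≫ c̄ = 1 ↔ ∀ a ∈ 𝔭, t ≫ ι(a) = 1` on ALL `T`-points, `c̄` surjective) — no degree count -/

section SchemeKernel

variable [IsAlgClosed Ω] [IsCommMonObj A.X]

/-- **RANK-FREE RECOGNITION OF THE SERRE TENSOR FROM THE SCHEME-THEORETIC KERNEL** (`Ω = Ω̄`, ANY characteristic): `φ : A → B` a homomorphism with
`φ.left` SURJECTIVE and `Ker φ = A[𝔭]` AS SUBGROUP FUNCTORS (`t ≫ φ = 1 ↔ ∀ a ∈ 𝔭, t ≫ ι(a) = 1` for every `T`-valued point — the shape of `Roof₀` (r2₀)) ⇒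
`∃ e : A ⊗_𝒪 𝔟 ≅ B`, `ψ_P ≫ e = φ`, `e` a homomorphism, unique.  (`φ.left` is finite — finitely many `Ω`-points in the kernel, all `N`-torsion, ★
`IsogenyOfFiniteKernelOnPoints` — hence flat, ★ `IsIsogeny.flat`; then ★ `AbelianSchemeHomDescentKernelEq`.)  Compared with ★
`SerreTensorRecognition.exists_iso_serreTranslate_comp_eq_of_forall_comp_eq_one`: no `[IsFinite φ.left] [Flat φ.left]`, no degrees, but BOTH kernel inclusions.
[cite: MumfordAV1970, §7 Thm. 4 (p. 72)] [cite: MilneCM2006, §7 (Def. 7.19, Prop. 7.22, Rem. 7.23, pp. 58–59)] -/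
theorem exists_iso_serreTranslate_comp_eq_of_comp_eq_one_iff_forall_mem [Surjective φ.left]
    (hN : N ≠ 0) (hP : E' * P = P) (hQ : Q * E' = Q)
    (hQP : Q * P = Matrix.scalar (Fin 1) (N : O)) (hPQ : P * Q = Matrix.scalar (Fin m) (N : O) * E')
    {𝔭 : Ideal O} (h𝔭 : Ideal.span (Set.range fun k => P k 0) = 𝔭)
    (hker : ∀ ⦃T : Over (Spec (.of Ω))⦄ (t : T ⟶ A.X), t ≫ φ = 1 ↔ ∀ a ∈ 𝔭, t ≫ act.i a = 1) :
    ∃ e : (serreTensor act E' hE').X ≅ B.X, serreTranslate act E' hE' P ≫ e.hom = φ ∧ IsMonHom e.hom ∧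
      ∀ χ : (serreTensor act E' hE').X ⟶ B.X, serreTranslate act E' hE' P ≫ χ = φ → χ = e.hom := by
  haveI := isMonHom_serreTranslate act E' hE' P
  haveI := isFinite_serreTranslate_left act E' hE' P Q hN hP hQ hQP hPQ
  haveI := flat_serreTranslate_left act E' hE' P Q hN hP hQ hQP hPQ
  haveI := surjective_serreTranslate_left act E' hE' P Q hN hP hQ hQP hPQ
  have hN𝔭 : (N : O) ∈ 𝔭 := natCast_mem_of_quasiInverse P Q hQP h𝔭
  haveI : IsFinite φ.left :=
    isFinite_left_of_surjective_of_finite_setOf_map_eq_one φ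
      (finite_setOf_map_eq_one_of_pow_eq_one φ N hN fun Pt hPt => pow_eq_one_of_forall_mem act hN𝔭 Pt ((hker Pt).1 hPt))
  haveI : Flat φ.left := flat_left_of_isFinite_of_surjective φ
  exact A.exists_iso_comp_eq_of_comp_eq_one_iff (serreTranslate act E' hE' P) φ fun T t =>
    (comp_serreTranslate_eq_one_iff_forall_mem act E' hE' P hP h𝔭 t).trans (hker t).symm

/-- **… `𝒪`-EQUIVARIANTLY**: with an `𝒪`-action `ι_B` on `B` making `φ` equivariant, the isomorphism intertwines the Serre action and `ι_B` (and any single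
intertwiner `ι(a) ≫ φ = φ ≫ b` is carried to `ι_{A⊗𝔟}(a) ≫ e = e ≫ b` by `serreAction_comp_eq_comp_of_comp_eq`, the (r4₀) shape).
[cite: MumfordAV1970, §7 Thm. 4 (p. 72)] [cite: MilneCM2006, §7 (Def. 7.19, Prop. 7.22, Rem. 7.23, pp. 58–59)] -/
theorem exists_iso_serreTranslate_comp_eq_equivariant_of_comp_eq_one_iff_forall_mem [Surjective φ.left] (actB : B.RingAction O)
    (hN : N ≠ 0) (hP : E' * P = P) (hQ : Q * E' = Q)
    (hQP : Q * P = Matrix.scalar (Fin 1) (N : O)) (hPQ : P * Q = Matrix.scalar (Fin m) (N : O) * E')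
    {𝔭 : Ideal O} (h𝔭 : Ideal.span (Set.range fun k => P k 0) = 𝔭)
    (hφ : ∀ a, act.i a ≫ φ = φ ≫ actB.i a)
    (hker : ∀ ⦃T : Over (Spec (.of Ω))⦄ (t : T ⟶ A.X), t ≫ φ = 1 ↔ ∀ a ∈ 𝔭, t ≫ act.i a = 1) :
    ∃ e : (serreTensor act E' hE').X ≅ B.X, serreTranslate act E' hE' P ≫ e.hom = φ ∧ IsMonHom e.hom ∧
      (∀ a, (serreAction act E' hE').i a ≫ e.hom = e.hom ≫ actB.i a) ∧
        ∀ χ : (serreTensor act E' hE').X ⟶ B.X, serreTranslate act E' hE' P ≫ χ = φ → χ = e.hom := by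
  obtain ⟨e, he, hmon, huniq⟩ :=
    exists_iso_serreTranslate_comp_eq_of_comp_eq_one_iff_forall_mem act E' hE' P Q φ hN hP hQ hQP hPQ h𝔭 hker
  exact ⟨e, he, hmon, fun a => serreAction_comp_eq_comp_of_comp_eq act E' hE' P Q φ hN hP hQ hQP hPQ e.hom he a (actB.i a) (hφ a), huniq⟩

end SchemeKernel

end AbelianSchemeOver

end Literature.AlgebraicGeometry.AbelianSchemes

end
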